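import Mathlib
import Summits.Ventures.PercRepro2.CutFarOA3Theorem

/-!
# The coincidence `o = b` is a theorem of the typed kernel (blind cell PercRepro2, p3 g3,
2026-08-25; `proofs/P3-BRIDGE.md` §11.15)

`TypedCoincidence.lean` (night-3) shows `K₃ ≡ 0` at `o = a₃` and records that the coincidences
`b = a₃` and `o = b` do NOT vanish — they stay in sub-claim S4's domain (`MarksDistinct` allows
them).  Here the second one is closed outright: with `b = o` the state of a copy has `Lb = Lo`,
`Hb = Ho`, and on VALID states (a mark that sees both roots forces `a₁ ↔ a₂` — transitivity of
the connection relation) the SIX-FOLD SYMMETRISATION of `KB` over the three copies is pointwise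
nonnegative (`symKOB_nonneg`, `decide +kernel` over the valid five-bit triples; the unsymmetrised
kernel does go negative, `−1` on 58 of the 2197 valid triples).  Since `6 · typedCount` is the
typed count of the symmetrised kernel (`six_mul_typedCount`), **every typed base with `o = b` is
nonnegative** (`typedCount_nonneg_of_o_eq_b`), for every finite graph, every `F`, `z` and
`τ ∈ {1, 2}` on `F`.  Own work; standard axioms.
-/

namespace Summit.Ventures.PercRepro2

open UnionCluster

namespace CovForm

namespace RootBridge

open OneTyped TypedA3 Untouched TypedFactor Separated

section CoincidenceOB

open Classical

/-- The five bits of a copy when `b = o`: `a₁ ↔ a₂`, `a₁ ↔ o`, `a₂ ↔ o`, `a₁ ↔ a₃`, `a₂ ↔ a₃`. -/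
abbrev R5ob := Bool × Bool × Bool × Bool × Bool

namespace R5ob
/-- `a₁ ↔ a₂`. -/
def q (r : R5ob) : Bool := r.1
/-- `a₁ ↔ o`. -/
def lo (r : R5ob) : Bool := r.2.1
/-- `a₂ ↔ o`. -/
def ho (r : R5ob) : Bool := r.2.2.1
/-- `a₁ ↔ a₃`. -/
def l3 (r : R5ob) : Bool := r.2.2.2.1
/-- `a₂ ↔ a₃`. -/
def h3 (r : R5ob) : Bool := r.2.2.2.2
end R5ob

/-- The seven-bit state of a copy with `b = o`. -/
def stOB (r : R5ob) : St := (r.q, r.lo, r.ho, r.lo, r.ho, r.l3, r.h3)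

/-- **Validity**: a mark connected to both roots forces `a₁ ↔ a₂`. -/
def ValidOB (r : R5ob) : Bool := (!(r.lo && r.ho) || r.q) && (!(r.l3 && r.h3) || r.q)

/-- The six-fold symmetrisation of the kernel over the three copies, on `b = o` states. -/
def symKOB (rx ry rw : R5ob) : ℤ :=
  KB (stOB rx) (stOB ry) (stOB rw) + KB (stOB rx) (stOB rw) (stOB ry) +
    KB (stOB ry) (stOB rx) (stOB rw) + KB (stOB ry) (stOB rw) (stOB rx) +
    KB (stOB rw) (stOB rx) (stOB ry) + KB (stOB rw) (stOB ry) (stOB rx)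

/-- **The symmetrised kernel is pointwise nonnegative at `o = b`** on valid state triples. -/
theorem symKOB_nonneg (rx ry rw : R5ob) (hx : ValidOB rx = true) (hy : ValidOB ry = true)
    (hw : ValidOB rw = true) : 0 ≤ symKOB rx ry rw := by
  revert rx ry rw
  decide +kernel

variable {V : Type*} {E : Type*} [Fintype E] [DecidableEq E] {R : Type*} [Field R]
  [LinearOrder R] [IsStrictOrderedRing R]
variable (ends : E → Sym2 V) (o a₁ a₂ a₃ : V)

/-- The five bits of a configuration. -/
noncomputable def rOB (x : Config E) : R5ob :=
  (decide (Conn ends x a₂ a₁), decide (Conn ends x a₁ o), decide (Conn ends x a₂ o),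
    decide (Conn ends x a₁ a₃), decide (Conn ends x a₂ a₃))

omit [Fintype E] [DecidableEq E] in
/-- The state of a copy with `b = o` is its five bits. -/
lemma st_eq_stOB (x : Config E) : st ends o a₁ a₂ a₃ o x = stOB (rOB ends o a₁ a₂ a₃ x) := by
  unfold st stOB rOB R5ob.q R5ob.lo R5ob.ho R5ob.l3 R5ob.h3
  rfl

omit [Fintype E] [DecidableEq E] in
/-- **The bits of a configuration are valid**: transitivity of the connection relation. -/
lemma rOB_valid (x : Config E) : ValidOB (rOB ends o a₁ a₂ a₃ x) = true := by
  unfold ValidOB rOB R5ob.q R5ob.lo R5ob.ho R5ob.l3 R5ob.h3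
  simp only [Bool.and_eq_true]
  refine ⟨?_, ?_⟩
  · exact imp_clause' _ _ _ fun h1 h2 => conn_trans h2 (conn_symm h1)
  · exact imp_clause' _ _ _ fun h1 h2 => conn_trans h2 (conn_symm h1)

/-- **Row 2′TRI at the coincidence `o = b`**: every typed base of the crux kernel with `b = o` is
nonnegative — for every finite graph, every typed set `F` with types in `{1, 2}`, every `z`. -/
theorem typedCount_nonneg_of_o_eq_b (F : Finset E) (z : Config E) (τ : E → ℕ)
    (hτ : ∀ e ∈ F, τ e = 1 ∨ τ e = 2) :
    0 ≤ typedCount F z τ (K3 ends o a₁ a₂ a₃ o : Config E → Config E → Config E → R) := by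
  have h6 := six_mul_typedCount F z τ hτ (K3 ends o a₁ a₂ a₃ o : Config E → Config E → Config E → R)
  have hK : (0 : R) ≤ typedCount F z τ (fun x y w => ((symKOB (rOB ends o a₁ a₂ a₃ x)
      (rOB ends o a₁ a₂ a₃ y) (rOB ends o a₁ a₂ a₃ w) : ℤ) : R)) := by
    refine typedCount_nonneg_of_nonneg _ _ _ fun x y w => ?_
    exact_mod_cast symKOB_nonneg _ _ _ (rOB_valid ends o a₁ a₂ a₃ x) (rOB_valid ends o a₁ a₂ a₃ y)
      (rOB_valid ends o a₁ a₂ a₃ w)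
  have hsym : typedCount F z τ (fun x y w => ((symKOB (rOB ends o a₁ a₂ a₃ x)
      (rOB ends o a₁ a₂ a₃ y) (rOB ends o a₁ a₂ a₃ w) : ℤ) : R)) =
      typedCount F z τ (fun x y w =>
        (K3 ends o a₁ a₂ a₃ o x y w : R) + K3 ends o a₁ a₂ a₃ o x w y + K3 ends o a₁ a₂ a₃ o y x w +
          K3 ends o a₁ a₂ a₃ o y w x + K3 ends o a₁ a₂ a₃ o w x y + K3 ends o a₁ a₂ a₃ o w y x) := by
    refine typedCount_congr' _ _ _ _ _ fun x y w => ?_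
    simp only [K3_eq_KB, st_eq_stOB]
    unfold symKOB
    push_cast
    ring
  have h6' : (0 : R) ≤ 6 * typedCount F z τ (K3 ends o a₁ a₂ a₃ o : Config E → Config E → Config E → R) := by
    rw [h6, ← hsym]
    exact hK
  exact (mul_nonneg_iff_of_pos_left (by norm_num : (0 : R) < 6)).mp h6'

end CoincidenceOB

end RootBridge

end CovForm

end Summit.Ventures.PercRepro2
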